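import Summits.QuantumFields.BalabanUV.T4Continuum.Support.NE7QbarLipschitzTower
import Summits.QuantumFields.BalabanUV.T4Continuum.Support.NE3QuadRemainderSup
import Summits.QuantumFields.BalabanUV.T4Continuum.Support.NE3CurlStability
import Literature.NumberTheory.Sieve.CoprimeSquarefreeSumsBounds
import HarnessLib

/-!
# NE7QbarLipschitzBudget — THE LETTER (TT-Q) AT THE TRIVIAL FLAT DATUM, DISCHARGED: for `Ũ = e^{A}`, `‖A‖ ≤ α₀ = α̂∕M`, `M = L^K`,
# `Σ_{z∈[0,N)^d} Σ_κ ‖Q̄^{(K)}_Ũ Y − Q^{(K)} Y‖ ≤ 2·C_S(d,L)·α̂ · M^{1−d} · ‖Y‖_{ℓ¹([0,MN)^d)}` — the link radii of the averaged backgrounds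
# `cavgIter i e^{A} = e^{relIter_i A}` are geometric (row NE3's `relIter` letters), so F50's budget is `O(α̂)`, k-UNIFORMLY (memo H15 §2)

Cell `pub-balaban`, rung (B)+1 sub-cell t4, lineage `b2b-balaban-t4-ne7-p1`, generation 71 (CRUX PROVER NE7 #1); memo
`t4/b2b-balaban-t4-ne7-p1-g71/HUNT-H15-EXP-LANDED-TT-CURRENCY.md` §2.  File F51 (over F50 `NE7QbarLipschitzTower` (`sum_norm_QbarIter_sub_flat_le_of_budget`),
row NE3 leaf-02's `NE3QuadRemainderSup` (`cavgIter_vary_eq_vary_relIter_of_tower`, `relIter_skew_of_tower`, `norm_relIter_le`: `cavgIter k (We^{X}) =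
(cavgIter k W)e^{relIter_k X}`, `‖relIter_k X‖ ≤ 2(3+12d)L^k s`), `NE3CurlStability.norm_vary_sub_le_of_sup`, `NE3LinearisedAverageSup.geom_sum_mul_le`,
`NE3TangentCovariantTower.cavgIter_flat`, `NE3QuadRemainderTower.vary_add_period`).
WHY (memo H15 §2).  The repaired test-field transport of (APE) costs `τ = a·C·M^{d−2}·Λ_Q` with `Λ_Q` the `ℓ¹→ℓ¹` norm of `Q̄^{(K)}_Ũ − Q^{(K)}`; F50 gives
`Λ_Q ≤ 2S·q^K` (`q = L∕L^d`, `q^K = M^{1−d}`) under the budget `Σ_{i<K}θ_i ≤ Sq`; THIS FILE computes the budget at the trivial flat datum: the averaged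
backgrounds of `e^{A}` are `e^{relIter_i A}` with `‖relIter_i A‖ ≤ 2c_D L^iα₀` (`c_D = 3+12d`), so their link radii are `η_i ≤ e^{2c_DL^iα₀} − 1 ≤ 4c_DL^iα₀`,
`Σ_{i≤K}η_i ≤ 8c_Dα̂`, and `S = C_S·α̂`, `C_S = 8c_D(2 + 2(d+1)L(1 + Cl1·L^{d−1}))`, `Cl1 = Csup·d(2nbRad+1)^d` — HENCE `τ ∼ δα̂M⁻³`, the H14 currency.
WHAT ([folklore]; 0 def, 0 sorry).  Throughout `2 ≤ L`, `A` skew `(L^K·N)`-periodic with `‖A‖ ≤ α₀`, `0 ≤ α₀`, the σ-line `4c_D²L^Kα₀ ≤ rho0²` of row NE3,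
and the flat tower data `LevelSmall d L K 0`, `curvSum d L K 0 ≤ (2∕3)L` as HYPOTHESES (F43 `NE7CoarseCurvatureLetter.levelSmall_zero ∕ curvSum_zero`
discharge them by name; F43's olean is not built on the farm today).
§1 **`cavgIter_vary_flat_eq`** (`cavgIter i e^{A} = e^{relIter_i A}`, `i ≤ K`), `isUnitaryCfg_cavgIter_vary_flat`,
   **`norm_cavgIter_vary_flat_sub_one_le`** (link radius `≤ e^{2c_DL^iα₀} − 1`).
§2 `sum_pow_le` (`Σ_{i<K+1}L^i ≤ 2L^K`), **`radii_budget`** (`Σ_{i<K}θ_i ≤ C_S·α̂·q` for the radii `η_i = e^{2c_DL^iα₀} − 1`,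
   under `2c_DL^Kα₀ ≤ 1`).
§3 **`sum_norm_QbarIter_vary_flat_sub_le`** — (TT-Q) AT THE TRIVIAL FLAT DATUM: under `C_S·α̂ ≤ 1` and `256(d+1)L·c_D·α̂ ≤ 1`,
   `Σ_{z∈[0,N)^d}Σ_κ ‖QbarIter L K (e^{A}) Y z κ − QbarIter L K 1 Y z κ‖ ≤ 2·C_S·α̂·(L∕L^d)^K·dirL1 Y (periodBox (L^K·N))`, `α̂ = L^Kα₀`.
HONEST FRAMING (page 1): lattice kinematics; the TT assembly (gauge correction + right inverse) and (APE) are NOT here; nothing of Bałaban's asserted;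
NOT ONE-STEP, NOT NE7; spine 0∕9; finite T⁴ rung (B)+1 — NOT infinite volume, NOT mass gap, NOT Clay.  Continuum YM on T⁴ ⇐ BetaPertH ∧ nine spine
estimates (0/9 proved); BetaPertH ⇐ (D1) ∧ (D4) ∧ CAP+tail; G-an2-4 gates asym, D1 and NE2/3/4.
-/

set_option autoImplicit false

open scoped BigOperators Matrix.Norms.L2Operator
open NormedSpace Finset

namespace Summit.QuantumFields.BalabanUV.T4Continuum.NE7QbarLipschitzBudget

open Literature.MathematicalPhysics.QuantumFieldTheory.Balaban1983to89
open B7Prop1Explicit B7Prop2Explicit MatrixLog UnitaryModel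
open T4AveragingDeficitWall (IsUnitaryCfg IsSkewDir SmallField vary dirL1 flat_mem_classes)
open T4AveragingDeficitWallBoundary (IsPeriodicCfg periodBox)
open AveragingDeficitPeriodicCounting (IsPeriodicDir)
open AveragingDeficitPlaqDeriv (vary_isUnitaryCfg)
open AveragingDeficitMultiLevelPrep (cavgIter LevelSmall)
open BlockAveragePushDirSplit (flat)
open BlockAverageVaryHolo (nbRad)
open BlockAverageVaryDisc (rho0)
open NE3CurlStability (norm_vary_sub_le_of_sup)
open NE3LinearisedAverageSup (curvSum geom_sum_mul_le)
open NE3QuadRemainderTower (relIter vary_add_period)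
open NE3QuadRemainderSup (cavgIter_vary_eq_vary_relIter_of_tower relIter_skew_of_tower norm_relIter_le)
open NE3TangentCovariantTower (QbarIter cavgIter_flat)
open NE7QbarLipschitzTower (sum_norm_QbarIter_sub_flat_le_of_budget)

noncomputable section

variable {d : ℕ} {n : Type*} [Fintype n] [DecidableEq n]

/-! ## §1 The averaged backgrounds of `e^{A}` and their link radii -/

/-- **`cavgIter L i (e^{A}) = e^{relIter_i A}`** for `i ≤ K` at the trivial flat datum (row NE3's consistency `cavgIter_vary_eq_vary_relIter_of_tower` at
`W = 1`, `cavgIter_flat`). [folklore] -/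
theorem cavgIter_vary_flat_eq [Nonempty n] {L N K : ℕ} [NeZero N] (hL : 2 ≤ L) (hs : LevelSmall d L K 0) (hcurv : curvSum d L K 0 ≤ 2 / 3 * L)
    {A : Site d → Fin d → Matrix n n ℂ} (hA : IsSkewDir A) (hAP : IsPeriodicDir A ((L ^ K * N : ℕ) : ℤ)) {α₀ : ℝ} (hα₀ : 0 ≤ α₀)
    (hAα : ∀ (y : Site d) (μ : Fin d), ‖A y μ‖ ≤ α₀) (hσ : 4 * (3 + 12 * (d : ℝ)) ^ 2 * (L : ℝ) ^ K * α₀ ≤ rho0 d L ^ 2) {i : ℕ} (hi : i ≤ K) :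
    cavgIter L i (vary (flat (d := d) (n := n)) A 1) = vary (flat (d := d) (n := n)) (relIter L i (flat (d := d) (n := n)) A) 1 := by
  have h := cavgIter_vary_eq_vary_relIter_of_tower hL (flat_mem_classes (d := d) (n := n) le_rfl).1 (fun _ _ _ => rfl) le_rfl hs
    (flat_mem_classes (d := d) (n := n) le_rfl).2 hcurv hA hAP hα₀ hAα hσ hi
  rw [cavgIter_flat] at h
  exact h

/-- The averaged backgrounds of `e^{A}` are unitary (`i ≤ K`). [folklore] -/
theorem isUnitaryCfg_cavgIter_vary_flat [Nonempty n] {L N K : ℕ} [NeZero N] (hL : 2 ≤ L) (hs : LevelSmall d L K 0)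
    (hcurv : curvSum d L K 0 ≤ 2 / 3 * L) {A : Site d → Fin d → Matrix n n ℂ} (hA : IsSkewDir A) (hAP : IsPeriodicDir A ((L ^ K * N : ℕ) : ℤ))
    {α₀ : ℝ} (hα₀ : 0 ≤ α₀) (hAα : ∀ (y : Site d) (μ : Fin d), ‖A y μ‖ ≤ α₀) (hσ : 4 * (3 + 12 * (d : ℝ)) ^ 2 * (L : ℝ) ^ K * α₀ ≤ rho0 d L ^ 2)
    {i : ℕ} (hi : i ≤ K) : IsUnitaryCfg (cavgIter L i (vary (flat (d := d) (n := n)) A 1)) := by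
  rw [cavgIter_vary_flat_eq hL hs hcurv hA hAP hα₀ hAα hσ hi]
  have hRs : IsSkewDir (relIter L i (flat (d := d) (n := n)) A) :=
    relIter_skew_of_tower hL (flat_mem_classes (d := d) (n := n) le_rfl).1 (fun _ _ _ => rfl) le_rfl hs
      (flat_mem_classes (d := d) (n := n) le_rfl).2 hcurv hA hAP hα₀ hAα hσ hi
  exact vary_isUnitaryCfg (flat_mem_classes (d := d) (n := n) le_rfl).1 hRs 1

/-- **THE LINK RADII OF THE AVERAGED BACKGROUNDS**: `‖(cavgIter L i e^{A})(b) − 1‖ ≤ e^{2(3+12d)L^iα₀} − 1` for `i ≤ K` (row NE3's sup letter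
`norm_relIter_le` + `NE3CurlStability.norm_vary_sub_le_of_sup`). [folklore] -/
theorem norm_cavgIter_vary_flat_sub_one_le [Nonempty n] {L N K : ℕ} [NeZero N] (hL : 2 ≤ L) (hs : LevelSmall d L K 0)
    (hcurv : curvSum d L K 0 ≤ 2 / 3 * L) {A : Site d → Fin d → Matrix n n ℂ} (hA : IsSkewDir A) (hAP : IsPeriodicDir A ((L ^ K * N : ℕ) : ℤ))
    {α₀ : ℝ} (hα₀ : 0 ≤ α₀) (hAα : ∀ (y : Site d) (μ : Fin d), ‖A y μ‖ ≤ α₀) (hσ : 4 * (3 + 12 * (d : ℝ)) ^ 2 * (L : ℝ) ^ K * α₀ ≤ rho0 d L ^ 2)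
    {i : ℕ} (hi : i ≤ K) (x : Site d) (μ : Fin d) :
    ‖((cavgIter L i (vary (flat (d := d) (n := n)) A 1) x μ : (Matrix n n ℂ)ˣ) : Matrix n n ℂ) - 1‖
      ≤ Real.exp (2 * (3 + 12 * (d : ℝ)) * (L : ℝ) ^ i * α₀) - 1 := by
  rw [cavgIter_vary_flat_eq hL hs hcurv hA hAP hα₀ hAα hσ hi]
  have hR : ∀ (z : Site d) (κ : Fin d), ‖relIter L i (flat (d := d) (n := n)) A z κ‖ ≤ 2 * (3 + 12 * (d : ℝ)) * (L : ℝ) ^ i * α₀ :=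
    fun z κ => norm_relIter_le hL (flat_mem_classes (d := d) (n := n) le_rfl).1 (fun _ _ _ => rfl) le_rfl hs
      (flat_mem_classes (d := d) (n := n) le_rfl).2 hcurv hA hAP hα₀ hAα hσ hi z κ
  have h := norm_vary_sub_le_of_sup (flat_mem_classes (d := d) (n := n) le_rfl).1 hR 1 x μ
  rw [abs_one, one_mul] at h
  exact h

/-! ## §2 The budget -/

omit [Fintype n] [DecidableEq n] in
/-- `Σ_{i<K+1} L^i ≤ 2·L^K` for `2 ≤ L`. [folklore] -/
theorem sum_pow_le {L : ℕ} (hL : 2 ≤ L) (K : ℕ) : ∑ i ∈ Finset.range (K + 1), (L : ℝ) ^ i ≤ 2 * (L : ℝ) ^ K := by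
  have hL2 : (2 : ℝ) ≤ L := by exact_mod_cast hL
  have h := geom_sum_mul_le L (K + 1)
  have hS0 : 0 ≤ ∑ i ∈ Finset.range (K + 1), (L : ℝ) ^ i := Finset.sum_nonneg fun i _ => by positivity
  rw [pow_succ] at h
  nlinarith

omit [Fintype n] [DecidableEq n] in
/-- **THE RADII BUDGET**: with `c_D = 3 + 12d`, `η_i = e^{2c_DL^iα₀} − 1`, `2c_DL^Kα₀ ≤ 1`, `2 ≤ L`, `q = L∕L^d > 0`, `Cl1 = Csup·d(2nbRad+1)^d`:
`Σ_{i<K} [(2η_{i+1} + 2(d+1)Lη_i)·q + 2(d+1)Lη_i·Cl1] ≤ (8c_D·(2 + 2(d+1)L·(1 + Cl1∕q)))·(L^Kα₀)·q` (`η_i ≤ 4c_DL^iα₀`, `Σ_{i≤K}L^i ≤ 2L^K`). [folklore] -/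
theorem radii_budget {L : ℕ} (hL : 2 ≤ L) (K : ℕ) {α₀ : ℝ} (hα₀ : 0 ≤ α₀) (hρ : 2 * (3 + 12 * (d : ℝ)) * (L : ℝ) ^ K * α₀ ≤ 1)
    {q Cl : ℝ} (hq : 0 < q) (hCl : 0 ≤ Cl) :
    ∑ i ∈ Finset.range K,
        ((2 * (Real.exp (2 * (3 + 12 * (d : ℝ)) * (L : ℝ) ^ (i + 1) * α₀) - 1)
            + 2 * (((d : ℝ) + 1) * L) * (Real.exp (2 * (3 + 12 * (d : ℝ)) * (L : ℝ) ^ i * α₀) - 1)) * q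
          + (2 * ((d : ℝ) + 1) * L * (Real.exp (2 * (3 + 12 * (d : ℝ)) * (L : ℝ) ^ i * α₀) - 1)) * Cl)
      ≤ (8 * (3 + 12 * (d : ℝ)) * (2 + 2 * (((d : ℝ) + 1) * L) * (1 + Cl / q))) * ((L : ℝ) ^ K * α₀) * q := by
  set c : ℝ := 3 + 12 * (d : ℝ) with hc
  have hc0 : 0 ≤ c := by rw [hc]; positivity
  have hL1 : (1 : ℝ) ≤ L := by exact_mod_cast (show 1 ≤ L by omega)
  set η : ℕ → ℝ := fun i => Real.exp (2 * c * (L : ℝ) ^ i * α₀) - 1 with hη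
  -- η_i ≤ 4 c L^i α₀ for i ≤ K
  have hηle : ∀ i, i ≤ K → η i ≤ 4 * c * (L : ℝ) ^ i * α₀ := by
    intro i hi
    have hpow : (L : ℝ) ^ i ≤ (L : ℝ) ^ K := pow_le_pow_right₀ hL1 hi
    have h0 : 0 ≤ 2 * c * (L : ℝ) ^ i * α₀ := by positivity
    have h1 : 2 * c * (L : ℝ) ^ i * α₀ ≤ 1 := by
      have key : (L : ℝ) ^ i * α₀ ≤ (L : ℝ) ^ K * α₀ := mul_le_mul_of_nonneg_right hpow hα₀
      have : 2 * c * (L : ℝ) ^ i * α₀ ≤ 2 * c * (L : ℝ) ^ K * α₀ := by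
        calc 2 * c * (L : ℝ) ^ i * α₀ = 2 * c * ((L : ℝ) ^ i * α₀) := by ring
          _ ≤ 2 * c * ((L : ℝ) ^ K * α₀) := mul_le_mul_of_nonneg_left key (by positivity)
          _ = 2 * c * (L : ℝ) ^ K * α₀ := by ring
      exact this.trans hρ
    have h := Literature.NumberTheory.Sieve.SquarefreeSums.exp_sub_one_le_two_mul h0 h1
    simp only [hη]; linarith
  have hη0 : ∀ i, 0 ≤ η i := fun i => by
    simp only [hη]
    have : 0 ≤ 2 * c * (L : ℝ) ^ i * α₀ := by positivity
    linarith [Real.one_le_exp this]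
  -- the sum of the radii over i ≤ K
  have hsumη : ∑ i ∈ Finset.range (K + 1), η i ≤ 8 * c * ((L : ℝ) ^ K * α₀) := by
    calc ∑ i ∈ Finset.range (K + 1), η i ≤ ∑ i ∈ Finset.range (K + 1), 4 * c * (L : ℝ) ^ i * α₀ :=
          Finset.sum_le_sum fun i hi => hηle i (by simpa [Finset.mem_range, Nat.lt_succ_iff] using hi)
      _ = 4 * c * α₀ * ∑ i ∈ Finset.range (K + 1), (L : ℝ) ^ i := by rw [Finset.mul_sum]; exact Finset.sum_congr rfl fun i _ => by ring
      _ ≤ 4 * c * α₀ * (2 * (L : ℝ) ^ K) := mul_le_mul_of_nonneg_left (sum_pow_le hL K) (by positivity)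
      _ = 8 * c * ((L : ℝ) ^ K * α₀) := by ring
  -- termwise: θ_i ≤ (2 η_{i+1} + B η_i) q with B = 2(d+1)L(1 + Cl/q)
  set B : ℝ := 2 * (((d : ℝ) + 1) * L) * (1 + Cl / q) with hB
  have hB0 : 0 ≤ B := by rw [hB]; positivity
  have hq' : q ≠ 0 := hq.ne'
  have hterm : ∀ i, (2 * η (i + 1) + 2 * (((d : ℝ) + 1) * L) * η i) * q + (2 * ((d : ℝ) + 1) * L * η i) * Cl
      = (2 * η (i + 1) + B * η i) * q := fun i => by
    rw [hB]
    field_simp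
    ring
  have hsplit : ∑ i ∈ Finset.range K, (2 * η (i + 1) + B * η i) * q
      = (2 * q) * ∑ i ∈ Finset.range K, η (i + 1) + (B * q) * ∑ i ∈ Finset.range K, η i := by
    rw [Finset.mul_sum, Finset.mul_sum, ← Finset.sum_add_distrib]
    exact Finset.sum_congr rfl fun i _ => by ring
  -- both partial sums are ≤ the full sum over range (K+1)
  have hs1 : ∑ i ∈ Finset.range K, η (i + 1) ≤ ∑ i ∈ Finset.range (K + 1), η i := by
    rw [Finset.sum_range_succ']
    linarith [hη0 0]
  have hs2 : ∑ i ∈ Finset.range K, η i ≤ ∑ i ∈ Finset.range (K + 1), η i := by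
    rw [Finset.sum_range_succ]
    linarith [hη0 K]
  have hmain : ∑ i ∈ Finset.range K, (2 * η (i + 1) + B * η i) * q ≤ (2 + B) * (8 * c * ((L : ℝ) ^ K * α₀)) * q := by
    rw [hsplit]
    calc (2 * q) * ∑ i ∈ Finset.range K, η (i + 1) + (B * q) * ∑ i ∈ Finset.range K, η i
        ≤ (2 * q) * (8 * c * ((L : ℝ) ^ K * α₀)) + (B * q) * (8 * c * ((L : ℝ) ^ K * α₀)) :=
          add_le_add (mul_le_mul_of_nonneg_left (hs1.trans hsumη) (by positivity))
            (mul_le_mul_of_nonneg_left (hs2.trans hsumη) (by positivity))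
      _ = (2 + B) * (8 * c * ((L : ℝ) ^ K * α₀)) * q := by ring
  calc ∑ i ∈ Finset.range K,
        ((2 * (Real.exp (2 * (3 + 12 * (d : ℝ)) * (L : ℝ) ^ (i + 1) * α₀) - 1)
            + 2 * (((d : ℝ) + 1) * L) * (Real.exp (2 * (3 + 12 * (d : ℝ)) * (L : ℝ) ^ i * α₀) - 1)) * q
          + (2 * ((d : ℝ) + 1) * L * (Real.exp (2 * (3 + 12 * (d : ℝ)) * (L : ℝ) ^ i * α₀) - 1)) * Cl)
      = ∑ i ∈ Finset.range K, (2 * η (i + 1) + B * η i) * q := Finset.sum_congr rfl fun i _ => hterm i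
    _ ≤ (2 + B) * (8 * c * ((L : ℝ) ^ K * α₀)) * q := hmain
    _ = (8 * (3 + 12 * (d : ℝ)) * (2 + 2 * (((d : ℝ) + 1) * L) * (1 + Cl / q))) * ((L : ℝ) ^ K * α₀) * q := by rw [hB, hc]; ring

/-! ## §3 (TT-Q) AT THE TRIVIAL FLAT DATUM -/

/-- **THE LETTER (TT-Q) AT THE TRIVIAL FLAT DATUM.**  `2 ≤ L`, `N ≥ 1`, `K` levels; `A` skew `(L^K·N)`-periodic with `‖A‖ ≤ α₀`, `0 ≤ α₀`; row NE3's
σ-line `4(3+12d)²L^Kα₀ ≤ rho0²`; the flat tower data `LevelSmall d L K 0`, `curvSum d L K 0 ≤ (2∕3)L` (F43 `levelSmall_zero`, `curvSum_zero`); the smallness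
lines `C_S·(L^Kα₀) ≤ 1` and `256(d+1)L(3+12d)·(L^Kα₀) ≤ 1`, `C_S = 8(3+12d)(2 + 2(d+1)L(1 + Cl1·L^d∕L))`, `Cl1 = (1250(nbRad+L) + 8dL + 2L)·d(2nbRad+1)^d`;
`Y` `(L^K·N)`-periodic.  Then

  `Σ_{z∈[0,N)^d} Σ_κ ‖QbarIter L K (e^{A}) Y z κ − QbarIter L K 1 Y z κ‖ ≤ 2·C_S·(L^Kα₀)·(L∕L^d)^K · dirL1 Y (periodBox (L^K·N))`

— with `M = L^K`, `α̂ = Mα₀`: `Λ_Q = 2C_Sα̂·M^{1−d}`, the currency memo H15 §2 needs (`τ ∼ δα̂M⁻³`). [folklore] -/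
theorem sum_norm_QbarIter_vary_flat_sub_le [Nonempty n] {L N K : ℕ} [NeZero N] (hL : 2 ≤ L) (hs : LevelSmall d L K 0)
    (hcurv : curvSum d L K 0 ≤ 2 / 3 * L) {A : Site d → Fin d → Matrix n n ℂ} (hA : IsSkewDir A) (hAP : IsPeriodicDir A ((L ^ K * N : ℕ) : ℤ))
    {α₀ : ℝ} (hα₀ : 0 ≤ α₀) (hAα : ∀ (y : Site d) (μ : Fin d), ‖A y μ‖ ≤ α₀) (hσ : 4 * (3 + 12 * (d : ℝ)) ^ 2 * (L : ℝ) ^ K * α₀ ≤ rho0 d L ^ 2)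
    (hS1 : (8 * (3 + 12 * (d : ℝ)) * (2 + 2 * (((d : ℝ) + 1) * L)
        * (1 + ((1250 * ((nbRad d L : ℝ) + L) + 8 * (d * L) + 2 * L) * (d * (2 * nbRad d L + 1) ^ d)) / ((L : ℝ) / (L : ℝ) ^ d))))
        * ((L : ℝ) ^ K * α₀) ≤ 1)
    (hb : 256 * ((d : ℝ) + 1) * L * (3 + 12 * (d : ℝ)) * ((L : ℝ) ^ K * α₀) ≤ 1)
    (Y : Site d → Fin d → Matrix n n ℂ) (hY : IsPeriodicDir Y ((L ^ K * N : ℕ) : ℤ)) :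
    ∑ z ∈ periodBox N, ∑ κ : Fin d, ‖QbarIter L K (vary (flat (d := d) (n := n)) A 1) Y z κ - QbarIter L K (flat (d := d) (n := n)) Y z κ‖
      ≤ 2 * ((8 * (3 + 12 * (d : ℝ)) * (2 + 2 * (((d : ℝ) + 1) * L)
            * (1 + ((1250 * ((nbRad d L : ℝ) + L) + 8 * (d * L) + 2 * L) * (d * (2 * nbRad d L + 1) ^ d)) / ((L : ℝ) / (L : ℝ) ^ d))))
          * ((L : ℝ) ^ K * α₀))
        * ((L : ℝ) / (L : ℝ) ^ d) ^ K * dirL1 Y (periodBox (L ^ K * N)) := by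
  have hL1 : 1 ≤ L := by omega
  have hN : 1 ≤ N := Nat.one_le_iff_ne_zero.mpr (NeZero.ne N)
  have hLr : (0 : ℝ) < L := by exact_mod_cast (show 0 < L by omega)
  set c : ℝ := 3 + 12 * (d : ℝ) with hc
  have hc3 : (3 : ℝ) ≤ c := by rw [hc]; have : (0:ℝ) ≤ d := Nat.cast_nonneg d; linarith
  set q : ℝ := (L : ℝ) / (L : ℝ) ^ d with hq
  have hq0 : 0 < q := by rw [hq]; positivity
  set Cl : ℝ := (1250 * ((nbRad d L : ℝ) + L) + 8 * (d * L) + 2 * L) * (d * (2 * nbRad d L + 1) ^ d) with hCl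
  have hCl0 : 0 ≤ Cl := by rw [hCl]; positivity
  -- the radii
  set η : ℕ → ℝ := fun i => Real.exp (2 * c * (L : ℝ) ^ i * α₀) - 1 with hη
  have hη0 : ∀ i, 0 ≤ η i := fun i => by
    simp only [hη]
    have : 0 ≤ 2 * c * (L : ℝ) ^ i * α₀ := by positivity
    linarith [Real.one_le_exp this]
  -- 2 c L^K α₀ ≤ 1 (from the 256-line, c ≥ 3)
  have hMα : 0 ≤ (L : ℝ) ^ K * α₀ := by positivity
  have hρ : 2 * c * (L : ℝ) ^ K * α₀ ≤ 1 := by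
    have hd1 : (1 : ℝ) ≤ (d : ℝ) + 1 := by have : (0:ℝ) ≤ d := Nat.cast_nonneg d; linarith
    have hL1r : (1 : ℝ) ≤ L := by exact_mod_cast hL1
    have : 2 * c * ((L : ℝ) ^ K * α₀) ≤ 256 * ((d : ℝ) + 1) * L * c * ((L : ℝ) ^ K * α₀) := by
      have h256 : (2 : ℝ) * c ≤ 256 * ((d : ℝ) + 1) * L * c := by nlinarith
      exact mul_le_mul_of_nonneg_right h256 hMα
    nlinarith
  -- η_i ≤ 4 c L^K α₀ ⟹ 2(d+1)L η_i ≤ 1/32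
  have hsm : ∀ i, i < K → 2 * ((d : ℝ) + 1) * L * η i ≤ 1 / 32 := by
    intro i hi
    have hpow : (L : ℝ) ^ i ≤ (L : ℝ) ^ K := pow_le_pow_right₀ (by exact_mod_cast hL1) hi.le
    have h0 : 0 ≤ 2 * c * (L : ℝ) ^ i * α₀ := by positivity
    have hle : 2 * c * (L : ℝ) ^ i * α₀ ≤ 2 * c * (L : ℝ) ^ K * α₀ := by
      have key : (L : ℝ) ^ i * α₀ ≤ (L : ℝ) ^ K * α₀ := mul_le_mul_of_nonneg_right hpow hα₀
      calc 2 * c * (L : ℝ) ^ i * α₀ = 2 * c * ((L : ℝ) ^ i * α₀) := by ring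
        _ ≤ 2 * c * ((L : ℝ) ^ K * α₀) := mul_le_mul_of_nonneg_left key (by positivity)
        _ = 2 * c * (L : ℝ) ^ K * α₀ := by ring
    have h := Literature.NumberTheory.Sieve.SquarefreeSums.exp_sub_one_le_two_mul h0 (hle.trans hρ)
    have hηi : η i ≤ 4 * c * ((L : ℝ) ^ K * α₀) := by simp only [hη]; nlinarith
    have hpos : 0 ≤ 2 * ((d : ℝ) + 1) * L := by positivity
    calc 2 * ((d : ℝ) + 1) * L * η i ≤ 2 * ((d : ℝ) + 1) * L * (4 * c * ((L : ℝ) ^ K * α₀)) := mul_le_mul_of_nonneg_left hηi hpos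
      _ = (256 * ((d : ℝ) + 1) * L * c * ((L : ℝ) ^ K * α₀)) / 32 := by ring
      _ ≤ 1 / 32 := by rw [hc]; linarith
  -- the tower data for F50
  have hUP : IsPeriodicCfg (vary (flat (d := d) (n := n)) A 1) ((L ^ K * N : ℕ) : ℤ) := vary_add_period (fun _ _ _ => rfl) hAP 1
  have hWu : ∀ i, i ≤ K → IsUnitaryCfg (cavgIter L i (vary (flat (d := d) (n := n)) A 1)) := fun i hi =>
    isUnitaryCfg_cavgIter_vary_flat hL hs hcurv hA hAP hα₀ hAα hσ hi
  have hrad : ∀ i, i ≤ K → ∀ (x : Site d) (μ : Fin d),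
      ‖((cavgIter L i (vary (flat (d := d) (n := n)) A 1) x μ : (Matrix n n ℂ)ˣ) : Matrix n n ℂ) - 1‖ ≤ η i := fun i hi x μ => by
    have h := norm_cavgIter_vary_flat_sub_one_le hL hs hcurv hA hAP hα₀ hAα hσ hi x μ
    simpa only [hη, hc] using h
  -- the budget
  have hbud := radii_budget (d := d) hL K hα₀ (by simpa only [hc] using hρ) hq0 hCl0
  set S : ℝ := (8 * c * (2 + 2 * (((d : ℝ) + 1) * L) * (1 + Cl / q))) * ((L : ℝ) ^ K * α₀) with hSdef
  have hS1' : S ≤ 1 := by simpa only [hSdef, hc, hCl, hq] using hS1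
  have hbud' : ∑ i ∈ Finset.range K, ((2 * η (i + 1) + 2 * (((d : ℝ) + 1) * L) * η i) * ((L : ℝ) / (L : ℝ) ^ d)
      + (2 * ((d : ℝ) + 1) * L * η i) * ((1250 * ((nbRad d L : ℝ) + L) + 8 * (d * L) + 2 * L) * (d * (2 * nbRad d L + 1) ^ d)))
        ≤ S * ((L : ℝ) / (L : ℝ) ^ d) := by
    simpa only [hη, hc, hq, hCl, hSdef] using hbud
  have h := sum_norm_QbarIter_sub_flat_le_of_budget (d := d) (n := n) hL1 K hN η hUP hWu hrad hη0 hsm hS1' hbud' Y hY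
  simpa only [hSdef, hc, hCl, hq] using h

end

end Summit.QuantumFields.BalabanUV.T4Continuum.NE7QbarLipschitzBudget
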